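/-
Copyright (c) 2026 the pub-hodgecm-mathlib formalisation cell (harness21).  Prover seat hodgecm-mathlib-K2E1-p11 (g2), Track B ∕ K2-LIT, h413 =
`stmt-HodgeConjecture-24833`, line `K2_E1_TraceFormulaBeta`, 5Res campaign «ENDGAME BY FAMILIES» (ROADCARD (154) of K2E1-plan (g7)), deal P3b (STATUS #1 ∕ (158) ∕ (190) «=»), FILE 2 of 2:
the transformed radial profile `f_h(t) = ∫ f(t·H(y)) h(y) dμ(y)` (its regularity and compact support in `(0,∞)`), the MELLIN MULTIPLIER `f̃_h = ĥ·f̃`, and — with the Weyl symmetry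
★ (G1) `sphericalTransform_symm_cm_two` — the unitary-axis model identity `U_{f_h}(t) = ĥ(½+it)·U_f(t)` of the intertwining `U∘R(h) = M_ĥ∘U` for `U(1,1)_{L∕L⁺}`.
-/
import Summits.HodgeConjecture.HodgeConjecture.Theorems.K2E1SphericalTransformSymmetryU       -- ★ (G1) (K2E1-p13): `sphericalTransform_symm_cm_two` (ĥ(z) = ĥ(1−z)); brings ★ `K2E1SphericalHeckeEigenSectionU2` (`continuous_borelHeight_coe`, `borelHeight_coe_pos`)
import Summits.HodgeConjecture.HodgeConjecture.Theorems.K2E1PseudoEisensteinRadialCMTwo        -- ★ D0 (K2E3-p12): `exists_one_le_forall_eq_zero` (support of a radial profile in `(T⁻¹, T)`); brings `Mathlib.Analysis.MellinTransform`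
import HarnessLib

/-!
# P3b FILE 2 — `K2E1PseudoEisensteinHeckeIntertwiningCMTwo`: the profile `f_h`, the Mellin multiplier `f̃_h = ĥ·f̃`, and the axis model identity `U_{f_h} = ĥ(½+it)·U_f` for `U(1,1)_{L∕L⁺}`

Cell `pub/hodgecm-mathlib`, crux H413 = `stmt-HodgeConjecture-24833`, route `HCCMUnconditional`; dealer K2E1-plan (g7) ROADCARD (154) row C5 (T5b ∕ intertwining), rulings (158)∕(190).
THEOREMS ONLY (no `def` ∕ `instance` ∕ `notation` ∕ named-fact hypothesis ∕ `sorry`; default heartbeats; `f_h(t) := ∫ f(t·H(y)) h(y) dμ(y)` and `ĥ(z) := ∫ h(x)·H(x)^z dμ(x)` are SPELLED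
INLINE); lane `--kind proof --supports stmt-HodgeConjecture-24833 --as helper` (count-neutral; closes no socket).  Companion of ★∕📤 FILE 1 `K2E1PseudoEisensteinHeckeStableCMTwo`
(`R(h)θ_f = θ_{f_h}`).
THE MATHEMATICS ([MoeglinWaldspurger1995, II.1.2–II.1.4, II.2.4, IV.1.10]; [Langlands1976, §6 p. 167]; [Iwaniec2002, §7.3]; [Titchmarsh1948, §1.29]).  Let `h ∈ C_c(G(𝔸))` and `f ∈ C_c((0,∞))`
(`f = 0` off `(T⁻¹, T)`, ★ D0 `exists_one_le_forall_eq_zero`); on the support of `h` the height is pinched, `c₁ ≤ H ≤ c₂` with `c₁ > 0` (§1), so `t·H(y)` leaves `(T⁻¹, T)` as soon as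
`t < T⁻¹∕c₂` or `t > T∕c₁`: **`f_h ∈ C_c((0,∞))`** (§1), continuous and — differentiating under the integral sign, `(d∕dt) f(tH(y))h(y) = f′(tH(y))·(H(y)h(y))`, the SAME shape with
`(f, h) ↦ (f′, H·h)` — **`C^n` whenever `f` is** (§2, dominated differentiation `hasDerivAt_integral_of_dominated_loc_of_deriv_le`, induction on `n` via `contDiff_succ_iff_deriv`).
MELLIN (§3): by Fubini on `(0,∞) × G(𝔸)` (the integrand is continuous with compact support in `[T⁻¹∕c₂, T∕c₁] × tsupport h`, majorant `‖t^{s−1}‖·𝟙·‖f‖_∞ ⊗ ‖h‖`) and the substitution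
`mellin (f(·a)) s = a^{−s}·mellin f s` (Mathlib `mellin_comp_mul_right`): **`mellin f_h s = (∫ h·H^{−s} dμ)·mellin f s`**, i.e. `f̃_h(z) = ĥ(z)·f̃(z)` in the convention `f̃(z) = mellin f (−z)`,
`ĥ(z) = ∫ h·H^z`.  AXIS (§4, CM pair, `N = 2`, `h` left-`K_U`-invariant, `ν_G` Haar): the model vector of ★ P2 `pseudoEisenstein_plancherelForm_of_fe` is
`U_f(t) = f̃(½+it) + cI(½−it)·f̃(½−it)`; since `ĥ(½−it) = ĥ(1 − (½−it)) = ĥ(½+it)` (★ (G1)), **`U_{f_h}(t) = ĥ(½+it)·U_f(t)`** and `f̃_h(1) = ĥ(1)·f̃(1)` on the residue coordinate — the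
generator-wise form of `U∘R(h) = M_ĥ∘U` (`M_ĥ` = `ĥ(1)` on the residue line, multiplication by `ĥ(½+it)` on `L²((0,∞))`); the passage to the closed span is ★∕📤 D4′b
`K2E1IsometryIntertwinesOfGram` (K2E4-p23), the `L²(X)`-operator reading of `R(h)` the consumer's `hRop` (model ★ `rightRegular_inv_apply_toLp_pseudoEisenstein`).
* §1 (generic `(F,E,c,N)`) `exists_borelHeight_bounds_of_hasCompactSupport`, `radialConv_integrand_eq_zero`, `radialConv_eq_zero`, **`hasCompactSupport_radialConv`**, **`tsupport_radialConv_subset_Ioi`**,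
  **`continuous_radialConv`**.  * §2 `hasDerivAt_radialConv`, **`contDiff_radialConv`**.  * §3 **`mellin_radialConv`**.
* §4 (CM, `N = 2`) **`axisModel_radialConv_eq_mul`**, `mellin_radialConv_neg_one`.
HONEST LABEL.  Count-neutral helper; proves no printed statement; letter-free (structural measure only; `cI` is a free function in §4).  HC_CM is proved only modulo the 7 printed citations
(2 remaining named inputs: hLiu418 = `stmt-HodgeConjecture-24832`, h413 = `stmt-HodgeConjecture-24833`) until rung 0 closes.

## References
* [MoeglinWaldspurger1995] C. Mœglin, J.-L. Waldspurger, *Spectral decomposition and Eisenstein series* (1995), II.1.2–II.1.4, II.2.4, IV.1.10.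
* [Langlands1976] R. P. Langlands, *On the Functional Equations Satisfied by Eisenstein Series*, LNM 544 (1976), §6 (p. 167).
* [Iwaniec2002] H. Iwaniec, *Spectral Methods of Automorphic Forms* (2nd ed., 2002), §7.3.
* [Titchmarsh1948] E. C. Titchmarsh, *Introduction to the Theory of Fourier Integrals* (1948), §1.29.
-/

set_option autoImplicit false
-- the mandated namespace repeats `HodgeConjecture.HodgeConjecture`, as in every `Theorems/*.lean` of this sub-problem
set_option linter.dupNamespace false

noncomputable section

open MeasureTheory MeasureTheory.Measure Set NumberField Filter Topology Complex
open scoped NNReal ENNReal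
open Literature.NumberTheory Literature.NumberTheory.Automorphic Literature.NumberTheory.Automorphic.UnitaryGroup AdelicGroupData
open Summit.HodgeConjecture.HodgeConjecture.Cruxes.H413.K2E1SphericalHeckeEigenSectionU2 (continuous_borelHeight_coe borelHeight_coe_pos)
open Summit.HodgeConjecture.HodgeConjecture.Cruxes.H413.K2E1PseudoEisensteinRadialCMTwo (exists_one_le_forall_eq_zero)
open Summit.HodgeConjecture.HodgeConjecture.Cruxes.H413.K2E1SphericalTransformSymmetryU (sphericalTransform_symm_cm_two)

namespace Summit.HodgeConjecture.HodgeConjecture.Cruxes.H413.K2E1PseudoEisensteinHeckeIntertwiningCMTwo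

section Generic

variable {F E : Type} [Field F] [NumberField F] [Field E] [NumberField E] [Algebra F E] {c : E ≃ₐ[F] E} {N : ℕ} [NeZero N]

/-! ## §1 The profile `f_h(t) = ∫ f(t·H(y)) h(y) dμ(y)`: support and continuity -/

/-- **THE HEIGHT IS PINCHED ON THE SUPPORT OF `h`**: for `h` of compact support there are `0 < c₁ ≤ c₂` with `c₁ ≤ H(y) ≤ c₂` whenever `h(y) ≠ 0` (`H` is continuous and positive, `tsupport h`
compact). [folklore] -/
theorem exists_borelHeight_bounds_of_hasCompactSupport {h : (quasiSplit F E c N).Adelic → ℂ} (hhs : HasCompactSupport h) :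
    ∃ c₁ c₂ : ℝ, 0 < c₁ ∧ c₁ ≤ c₂ ∧ ∀ y : (quasiSplit F E c N).Adelic, h y ≠ 0 → c₁ ≤ (borelHeight y : ℝ) ∧ (borelHeight y : ℝ) ≤ c₂ := by
  by_cases hne : (tsupport h).Nonempty
  · obtain ⟨y₁, hy₁, hmin⟩ := hhs.isCompact.exists_isMinOn hne continuous_borelHeight_coe.continuousOn
    obtain ⟨y₂, hy₂, hmax⟩ := hhs.isCompact.exists_isMaxOn hne continuous_borelHeight_coe.continuousOn
    refine ⟨(borelHeight y₁ : ℝ), (borelHeight y₂ : ℝ), borelHeight_coe_pos y₁, hmin hy₂, fun y hy => ?_⟩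
    have hyK : y ∈ tsupport h := subset_tsupport _ (Function.mem_support.2 hy)
    exact ⟨hmin hyK, hmax hyK⟩
  · refine ⟨1, 1, one_pos, le_rfl, fun y hy => ?_⟩
    exact (hne ⟨y, subset_tsupport _ (Function.mem_support.2 hy)⟩).elim

/-- **THE INTEGRAND VANISHES OFF `[T⁻¹∕c₂, T∕c₁]`**: if `f(r) = 0` for `r > T` and for `r < T⁻¹`, and `c₁ ≤ H ≤ c₂` on `{h ≠ 0}` (`c₁ > 0`), then `f(t·H(y))·h(y) = 0` for every `y` as soon as
`t < T⁻¹∕c₂` or `T∕c₁ < t`. [folklore] -/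
theorem radialConv_integrand_eq_zero {h : (quasiSplit F E c N).Adelic → ℂ} {f : ℝ → ℂ} {T : ℝ≥0} (hT : 1 ≤ T) (hhi : ∀ r : ℝ, (T : ℝ) < r → f r = 0) (hlo : ∀ r : ℝ, r < (T : ℝ)⁻¹ → f r = 0)
    {c₁ c₂ : ℝ} (hc₁ : 0 < c₁) (hc₁₂ : c₁ ≤ c₂) (hH : ∀ y : (quasiSplit F E c N).Adelic, h y ≠ 0 → c₁ ≤ (borelHeight y : ℝ) ∧ (borelHeight y : ℝ) ≤ c₂)
    {t : ℝ} (ht : t < (T : ℝ)⁻¹ / c₂ ∨ (T : ℝ) / c₁ < t) (y : (quasiSplit F E c N).Adelic) : f (t * (borelHeight y : ℝ)) * h y = 0 := by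
  by_cases hy : h y = 0
  · rw [hy, mul_zero]
  obtain ⟨h₁, h₂⟩ := hH y hy
  have hc₂ : 0 < c₂ := hc₁.trans_le hc₁₂
  have hT0 : 0 < (T : ℝ) := one_pos.trans_le (by exact_mod_cast hT)
  rcases ht with ht | ht
  · rw [hlo _ ?_, zero_mul]
    rcases le_or_gt t 0 with ht0 | ht0
    · exact (mul_nonpos_of_nonpos_of_nonneg ht0 (borelHeight_coe_pos y).le).trans_lt (inv_pos.2 hT0)
    · calc t * (borelHeight y : ℝ) ≤ t * c₂ := mul_le_mul_of_nonneg_left h₂ ht0.le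
        _ < (T : ℝ)⁻¹ / c₂ * c₂ := mul_lt_mul_of_pos_right ht hc₂
        _ = (T : ℝ)⁻¹ := div_mul_cancel₀ _ hc₂.ne'
  · rw [hhi _ ?_, zero_mul]
    have ht0 : 0 < t := (div_pos hT0 hc₁).trans ht
    calc (T : ℝ) = (T : ℝ) / c₁ * c₁ := (div_mul_cancel₀ _ hc₁.ne').symm
      _ < t * c₁ := mul_lt_mul_of_pos_right ht hc₁
      _ ≤ t * (borelHeight y : ℝ) := mul_le_mul_of_nonneg_left h₁ ht0.le

variable [MeasurableSpace (quasiSplit F E c N).Adelic] [BorelSpace (quasiSplit F E c N).Adelic]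

omit [BorelSpace (quasiSplit F E c N).Adelic] in
/-- `f_h(t) = 0` for `t < T⁻¹∕c₂` and for `t > T∕c₁`. [folklore] -/
theorem radialConv_eq_zero (μ : Measure (quasiSplit F E c N).Adelic) {h : (quasiSplit F E c N).Adelic → ℂ} {f : ℝ → ℂ} {T : ℝ≥0} (hT : 1 ≤ T) (hhi : ∀ r : ℝ, (T : ℝ) < r → f r = 0)
    (hlo : ∀ r : ℝ, r < (T : ℝ)⁻¹ → f r = 0) {c₁ c₂ : ℝ} (hc₁ : 0 < c₁) (hc₁₂ : c₁ ≤ c₂) (hH : ∀ y : (quasiSplit F E c N).Adelic, h y ≠ 0 → c₁ ≤ (borelHeight y : ℝ) ∧ (borelHeight y : ℝ) ≤ c₂)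
    {t : ℝ} (ht : t < (T : ℝ)⁻¹ / c₂ ∨ (T : ℝ) / c₁ < t) : ∫ y, f (t * (borelHeight y : ℝ)) * h y ∂μ = 0 := by
  simp only [radialConv_integrand_eq_zero hT hhi hlo hc₁ hc₁₂ hH ht, integral_zero]

omit [BorelSpace (quasiSplit F E c N).Adelic] in
/-- **`f_h` HAS COMPACT SUPPORT** (`⊆ [T⁻¹∕c₂, T∕c₁]`) for `f ∈ C_c((0,∞))`-type support data and `h` of compact support. [cite: MoeglinWaldspurger1995, II.1.2] -/
theorem hasCompactSupport_radialConv (μ : Measure (quasiSplit F E c N).Adelic) {h : (quasiSplit F E c N).Adelic → ℂ} (hhs : HasCompactSupport h) {f : ℝ → ℂ} (hfs : HasCompactSupport f) (hf0 : tsupport f ⊆ Ioi 0) :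
    HasCompactSupport fun t : ℝ => ∫ y, f (t * (borelHeight y : ℝ)) * h y ∂μ := by
  obtain ⟨T, hT, hhi, hlo⟩ := exists_one_le_forall_eq_zero hfs hf0
  obtain ⟨c₁, c₂, hc₁, hc₁₂, hH⟩ := exists_borelHeight_bounds_of_hasCompactSupport hhs
  refine HasCompactSupport.intro (isCompact_Icc : IsCompact (Icc ((T : ℝ)⁻¹ / c₂) ((T : ℝ) / c₁))) fun t ht => ?_
  rw [mem_Icc, not_and_or, not_le, not_le] at ht
  exact radialConv_eq_zero μ hT hhi hlo hc₁ hc₁₂ hH ht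

omit [BorelSpace (quasiSplit F E c N).Adelic] in
/-- **`tsupport f_h ⊆ (0,∞)`** (indeed `⊆ [T⁻¹∕c₂, T∕c₁]`). [cite: MoeglinWaldspurger1995, II.1.2] -/
theorem tsupport_radialConv_subset_Ioi (μ : Measure (quasiSplit F E c N).Adelic) {h : (quasiSplit F E c N).Adelic → ℂ} (hhs : HasCompactSupport h) {f : ℝ → ℂ} (hfs : HasCompactSupport f) (hf0 : tsupport f ⊆ Ioi 0) :
    tsupport (fun t : ℝ => ∫ y, f (t * (borelHeight y : ℝ)) * h y ∂μ) ⊆ Ioi 0 := by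
  obtain ⟨T, hT, hhi, hlo⟩ := exists_one_le_forall_eq_zero hfs hf0
  obtain ⟨c₁, c₂, hc₁, hc₁₂, hH⟩ := exists_borelHeight_bounds_of_hasCompactSupport hhs
  have hT0 : 0 < (T : ℝ) := one_pos.trans_le (by exact_mod_cast hT)
  have hsub : Function.support (fun t : ℝ => ∫ y, f (t * (borelHeight y : ℝ)) * h y ∂μ) ⊆ Icc ((T : ℝ)⁻¹ / c₂) ((T : ℝ) / c₁) := by
    intro t ht
    by_contra hmem
    rw [mem_Icc, not_and_or, not_le, not_le] at hmem
    exact ht (radialConv_eq_zero μ hT hhi hlo hc₁ hc₁₂ hH hmem)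
  exact (closure_minimal hsub isClosed_Icc).trans fun t ht => (div_pos (inv_pos.2 hT0) (hc₁.trans_le hc₁₂)).trans_le ht.1

/-- **`f_h` IS CONTINUOUS** for `f` continuous of compact support and `h ∈ C_c(G(𝔸))`, `μ` finite on compacta (dominated convergence, majorant `‖f‖_∞·‖h‖`). [cite: MoeglinWaldspurger1995, II.1.2] -/
theorem continuous_radialConv (μ : Measure (quasiSplit F E c N).Adelic) [IsFiniteMeasureOnCompacts μ] {h : (quasiSplit F E c N).Adelic → ℂ} (hhc : Continuous h) (hhs : HasCompactSupport h) {f : ℝ → ℂ}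
    (hfc : Continuous f) (hfs : HasCompactSupport f) : Continuous fun t : ℝ => ∫ y, f (t * (borelHeight y : ℝ)) * h y ∂μ := by
  obtain ⟨Mf, hMf⟩ := hfc.bounded_above_of_compact_support hfs
  refine continuous_of_dominated (fun t => ((hfc.comp (continuous_const.mul continuous_borelHeight_coe)).mul hhc).aestronglyMeasurable)
    (fun t => Eventually.of_forall fun y => ?_) ((hhc.norm.integrable_of_hasCompactSupport hhs.norm).const_mul Mf)
    (Eventually.of_forall fun y => ((hfc.comp (continuous_id.mul continuous_const)).mul continuous_const))
  rw [norm_mul]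
  exact mul_le_mul_of_nonneg_right (hMf _) (norm_nonneg _)

/-! ## §2 Differentiation under the integral sign: `f_h ∈ C^n` when `f ∈ C^n_c` -/

/-- **`(d∕dt) f_h = (f′)_{H·h}`**: for `f ∈ C¹` of compact support, `f_h` has derivative `∫ f′(t·H(y))·(H(y)h(y)) dμ(y)` — the same shape with `(f, h) ↦ (f′, H·h)` (dominated differentiation,
majorant `c₂‖f′‖_∞‖h‖`). [cite: MoeglinWaldspurger1995, II.1.2] -/
theorem hasDerivAt_radialConv (μ : Measure (quasiSplit F E c N).Adelic) [IsFiniteMeasureOnCompacts μ] {h : (quasiSplit F E c N).Adelic → ℂ} (hhc : Continuous h) (hhs : HasCompactSupport h) {f : ℝ → ℂ}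
    (hf : ContDiff ℝ 1 f) (hfs : HasCompactSupport f) (t₀ : ℝ) :
    HasDerivAt (fun t : ℝ => ∫ y, f (t * (borelHeight y : ℝ)) * h y ∂μ) (∫ y, deriv f (t₀ * (borelHeight y : ℝ)) * ((((borelHeight y : ℝ)) : ℂ) * h y) ∂μ) t₀ := by
  obtain ⟨c₁, c₂, hc₁, hc₁₂, hH⟩ := exists_borelHeight_bounds_of_hasCompactSupport hhs
  have hfd : Differentiable ℝ f := hf.differentiable one_ne_zero
  have hf'c : Continuous (deriv f) := hf.continuous_deriv le_rfl
  obtain ⟨M', hM'⟩ := hf'c.bounded_above_of_compact_support hfs.deriv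
  have hM'0 : 0 ≤ M' := (norm_nonneg _).trans (hM' 0)
  have h := hasDerivAt_integral_of_dominated_loc_of_deriv_le (μ := μ) (x₀ := t₀) (s := univ) (bound := fun y => c₂ * M' * ‖h y‖)
    (F := fun t y => f (t * (borelHeight y : ℝ)) * h y) (F' := fun t y => deriv f (t * (borelHeight y : ℝ)) * ((((borelHeight y : ℝ)) : ℂ) * h y)) univ_mem
    (Eventually.of_forall fun t => (hf.continuous.comp (continuous_const.mul continuous_borelHeight_coe) |>.mul hhc).aestronglyMeasurable)
    (((hf.continuous.comp (continuous_const.mul continuous_borelHeight_coe)).mul hhc).integrable_of_hasCompactSupport hhs.mul_left)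
    (((hf'c.comp (continuous_const.mul continuous_borelHeight_coe)).mul ((continuous_ofReal.comp continuous_borelHeight_coe).mul hhc)).aestronglyMeasurable)
    (Eventually.of_forall fun y t _ => ?_) ((hhc.norm.integrable_of_hasCompactSupport hhs.norm).const_mul (c₂ * M'))
    (Eventually.of_forall fun y t _ => ?_)
  · exact h.2
  · -- the majorant
    by_cases hy : h y = 0
    · simp only [hy, mul_zero, norm_zero, le_refl]
    · rw [norm_mul, norm_mul, Complex.norm_real, Real.norm_of_nonneg (borelHeight_coe_pos y).le]
      have h2 := (hH y hy).2
      calc ‖deriv f (t * (borelHeight y : ℝ))‖ * ((borelHeight y : ℝ) * ‖h y‖) ≤ M' * (c₂ * ‖h y‖) :=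
            mul_le_mul (hM' _) (mul_le_mul_of_nonneg_right h2 (norm_nonneg _)) (mul_nonneg (borelHeight_coe_pos y).le (norm_nonneg _)) hM'0
        _ = c₂ * M' * ‖h y‖ := by ring
  · -- the pointwise derivative (chain rule)
    have h1 : HasDerivAt (fun t : ℝ => f (t * (borelHeight y : ℝ))) ((borelHeight y : ℝ) • deriv f (t * (borelHeight y : ℝ))) t :=
      (hfd (t * (borelHeight y : ℝ))).hasDerivAt.scomp t (hasDerivAt_mul_const (borelHeight y : ℝ))
    exact (h1.mul_const (h y)).congr_deriv (by rw [Complex.real_smul]; ring)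

/-- **`f_h ∈ C^n` WHEN `f ∈ C^n_c`** (`h ∈ C_c(G(𝔸))`, `μ` finite on compacta): induction on `n`, the derivative being the profile of `(f′, H·h)` (`hasDerivAt_radialConv`, `contDiff_succ_iff_deriv`).
[cite: MoeglinWaldspurger1995, II.1.2] -/
theorem contDiff_radialConv (μ : Measure (quasiSplit F E c N).Adelic) [IsFiniteMeasureOnCompacts μ] {h : (quasiSplit F E c N).Adelic → ℂ} (hhc : Continuous h) (hhs : HasCompactSupport h) {f : ℝ → ℂ} {n : ℕ}
    (hf : ContDiff ℝ n f) (hfs : HasCompactSupport f) : ContDiff ℝ n (fun t : ℝ => ∫ y, f (t * (borelHeight y : ℝ)) * h y ∂μ) := by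
  induction n generalizing h f with
  | zero => exact contDiff_zero.2 (continuous_radialConv μ hhc hhs hf.continuous hfs)
  | succ n ih =>
    push_cast at hf ⊢
    have hf1 : ContDiff ℝ 1 f := hf.of_le (by exact_mod_cast Nat.le_add_left 1 n)
    have hderiv : deriv (fun t : ℝ => ∫ y, f (t * (borelHeight y : ℝ)) * h y ∂μ) =
        fun t => ∫ y, deriv f (t * (borelHeight y : ℝ)) * ((((borelHeight y : ℝ)) : ℂ) * h y) ∂μ :=
      funext fun t => (hasDerivAt_radialConv μ hhc hhs hf1 hfs t).deriv
    refine contDiff_succ_iff_deriv.2 ⟨fun t => (hasDerivAt_radialConv μ hhc hhs hf1 hfs t).differentiableAt, fun hω => absurd hω (WithTop.natCast_ne_top n), ?_⟩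
    rw [hderiv]
    exact ih ((continuous_ofReal.comp continuous_borelHeight_coe).mul hhc) hhs.mul_left (contDiff_succ_iff_deriv.1 hf).2.2 hfs.deriv

/-! ## §3 The Mellin multiplier `mellin f_h s = (∫ h·H^{−s} dμ)·mellin f s` -/

/-- **THE MELLIN MULTIPLIER.**  For `h ∈ C_c(G(𝔸))`, `f ∈ C_c((0,∞))`, `μ` finite on compacta and s-finite, and every `s : ℂ`:
`mellin f_h s = (∫ h(y)·H(y)^{−s} dμ(y))·mellin f s`, i.e. `f̃_h(z) = ĥ(z)·f̃(z)` in the conventions `f̃(z) = mellin f (−z)`, `ĥ(z) = ∫ h·H^z`.  Fubini on `(0,∞) × G(𝔸)` (the integrand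
`t^{s−1}·f(tH(y))·h(y)` vanishes off `[T⁻¹∕c₂, T∕c₁] × tsupport h`, majorant `(‖t^{s−1}‖·𝟙_{[T⁻¹∕c₂, T∕c₁]}·‖f‖_∞)·‖h(y)‖`), then `mellin (f(·a)) s = a^{−s}·mellin f s` (Mathlib `mellin_comp_mul_right`) at
`a = H(y) > 0`. [cite: MoeglinWaldspurger1995, II.1.3–II.1.4] [cite: Titchmarsh1948, §1.29] -/
theorem mellin_radialConv (μ : Measure (quasiSplit F E c N).Adelic) [IsFiniteMeasureOnCompacts μ] [SFinite μ] {h : (quasiSplit F E c N).Adelic → ℂ} (hhc : Continuous h) (hhs : HasCompactSupport h)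
    {f : ℝ → ℂ} (hfc : Continuous f) (hfs : HasCompactSupport f) (hf0 : tsupport f ⊆ Ioi 0) (s : ℂ) :
    mellin (fun t : ℝ => ∫ y, f (t * (borelHeight y : ℝ)) * h y ∂μ) s = (∫ y, h y * ((((borelHeight y : ℝ)) : ℂ) ^ (-s)) ∂μ) * mellin f s := by
  obtain ⟨T, hT, hhi, hlo⟩ := exists_one_le_forall_eq_zero hfs hf0
  obtain ⟨c₁, c₂, hc₁, hc₁₂, hH⟩ := exists_borelHeight_bounds_of_hasCompactSupport hhs
  obtain ⟨Mf, hMf⟩ := hfc.bounded_above_of_compact_support hfs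
  have hMf0 : 0 ≤ Mf := (norm_nonneg _).trans (hMf 0)
  have hT0 : 0 < (T : ℝ) := one_pos.trans_le (by exact_mod_cast hT)
  have ha : 0 < (T : ℝ)⁻¹ / c₂ := div_pos (inv_pos.2 hT0) (hc₁.trans_le hc₁₂)
  -- the uncurried integrand on `(0,∞) × G(𝔸)`
  set Fn : ℝ → (quasiSplit F E c N).Adelic → ℂ := fun t y => ((t : ℂ) ^ (s - 1)) * (f (t * (borelHeight y : ℝ)) * h y) with hFn
  have hmeas : AEStronglyMeasurable (Function.uncurry Fn) ((volume.restrict (Ioi (0 : ℝ))).prod μ) := by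
    have h1 : AEStronglyMeasurable (fun p : ℝ × (quasiSplit F E c N).Adelic => ((p.1 : ℂ) ^ (s - 1))) ((volume.restrict (Ioi (0 : ℝ))).prod μ) :=
      (ContinuousOn.aestronglyMeasurable (fun t ht => (continuousAt_ofReal_cpow_const t (s - 1) (Or.inr (ne_of_gt ht))).continuousWithinAt)
        measurableSet_Ioi).comp_fst
    have h2 : Continuous fun p : ℝ × (quasiSplit F E c N).Adelic => f (p.1 * (borelHeight p.2 : ℝ)) * h p.2 :=
      (hfc.comp (continuous_fst.mul (continuous_borelHeight_coe.comp continuous_snd))).mul (hhc.comp continuous_snd)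
    exact h1.mul h2.aestronglyMeasurable
  have hbound : ∀ (t : ℝ) (y : (quasiSplit F E c N).Adelic), ‖Fn t y‖ ≤ (‖((t : ℂ) ^ (s - 1))‖ * (Icc ((T : ℝ)⁻¹ / c₂) ((T : ℝ) / c₁)).indicator (fun _ => Mf) t) * ‖h y‖ := by
    intro t y
    by_cases ht : t ∈ Icc ((T : ℝ)⁻¹ / c₂) ((T : ℝ) / c₁)
    · rw [indicator_of_mem ht, hFn, norm_mul, norm_mul, mul_assoc]
      exact mul_le_mul_of_nonneg_left (mul_le_mul_of_nonneg_right (hMf _) (norm_nonneg _)) (norm_nonneg _)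
    · have hz := radialConv_integrand_eq_zero hT hhi hlo hc₁ hc₁₂ hH (by rwa [mem_Icc, not_and_or, not_le, not_le] at ht) y
      rw [hFn]
      dsimp only
      rw [hz, mul_zero, norm_zero]
      exact mul_nonneg (mul_nonneg (norm_nonneg _) (indicator_nonneg (fun _ _ => hMf0) _)) (norm_nonneg _)
  have hint_t : Integrable (fun t : ℝ => ‖((t : ℂ) ^ (s - 1))‖ * (Icc ((T : ℝ)⁻¹ / c₂) ((T : ℝ) / c₁)).indicator (fun _ => Mf) t) (volume.restrict (Ioi (0 : ℝ))) := by
    have heq : (fun t : ℝ => ‖((t : ℂ) ^ (s - 1))‖ * (Icc ((T : ℝ)⁻¹ / c₂) ((T : ℝ) / c₁)).indicator (fun _ => Mf) t) =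
        (Icc ((T : ℝ)⁻¹ / c₂) ((T : ℝ) / c₁)).indicator (fun t => ‖((t : ℂ) ^ (s - 1))‖ * Mf) := by
      funext t
      by_cases ht : t ∈ Icc ((T : ℝ)⁻¹ / c₂) ((T : ℝ) / c₁)
      · rw [indicator_of_mem ht, indicator_of_mem ht]
      · rw [indicator_of_notMem ht, indicator_of_notMem ht, mul_zero]
    rw [heq, integrable_indicator_iff measurableSet_Icc]
    have hcont : ContinuousOn (fun t : ℝ => ‖((t : ℂ) ^ (s - 1))‖ * Mf) (Icc ((T : ℝ)⁻¹ / c₂) ((T : ℝ) / c₁)) := fun t ht =>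
      (((continuousAt_ofReal_cpow_const t (s - 1) (Or.inr (ha.trans_le ht.1).ne')).norm.mul continuousAt_const).continuousWithinAt)
    exact hcont.integrableOn_Icc.mono_measure restrict_le_self
  have hint : Integrable (Function.uncurry Fn) ((volume.restrict (Ioi (0 : ℝ))).prod μ) :=
    (hint_t.mul_prod (hhc.norm.integrable_of_hasCompactSupport hhs.norm)).mono' hmeas (Eventually.of_forall fun p => hbound p.1 p.2)
  -- Fubini and the substitution `t ↦ t∕H(y)`
  have hstep1 : mellin (fun t : ℝ => ∫ y, f (t * (borelHeight y : ℝ)) * h y ∂μ) s = ∫ t in Ioi (0 : ℝ), ∫ y, Fn t y ∂μ := by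
    rw [mellin]
    refine setIntegral_congr_fun measurableSet_Ioi fun t _ => ?_
    rw [hFn, smul_eq_mul, ← integral_const_mul]
  have hstep2 : ∀ y : (quasiSplit F E c N).Adelic, ∫ t in Ioi (0 : ℝ), Fn t y = h y * ((((borelHeight y : ℝ)) : ℂ) ^ (-s)) * mellin f s := by
    intro y
    have heq : (fun t : ℝ => Fn t y) = fun t : ℝ => h y * (((t : ℂ) ^ (s - 1)) • f (t * (borelHeight y : ℝ))) := by
      funext t
      rw [hFn, smul_eq_mul]
      ring
    rw [heq, integral_const_mul]
    change h y * mellin (fun t : ℝ => f (t * (borelHeight y : ℝ))) s = _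
    rw [mellin_comp_mul_right f s (borelHeight_coe_pos y), smul_eq_mul, mul_assoc]
  rw [hstep1, integral_integral_swap hint]
  simp_rw [hstep2]
  rw [integral_mul_const]

/-- The residue coordinate: `mellin f_h (−1) = (∫ h·H dμ)·mellin f (−1)` (`f̃_h(1) = ĥ(1)·f̃(1)`). [cite: MoeglinWaldspurger1995, II.1.4] -/
theorem mellin_radialConv_neg_one (μ : Measure (quasiSplit F E c N).Adelic) [IsFiniteMeasureOnCompacts μ] [SFinite μ] {h : (quasiSplit F E c N).Adelic → ℂ} (hhc : Continuous h) (hhs : HasCompactSupport h)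
    {f : ℝ → ℂ} (hfc : Continuous f) (hfs : HasCompactSupport f) (hf0 : tsupport f ⊆ Ioi 0) :
    mellin (fun t : ℝ => ∫ y, f (t * (borelHeight y : ℝ)) * h y ∂μ) (-1) = (∫ y, h y * ((((borelHeight y : ℝ)) : ℂ) ^ (1 : ℂ)) ∂μ) * mellin f (-1) := by
  rw [mellin_radialConv μ hhc hhs hfc hfs hf0, neg_neg]

end Generic

/-! ## §4 The unitary-axis model identity `U_{f_h}(t) = ĥ(½+it)·U_f(t)` for `U(1,1)_{L∕L⁺}` -/

section Two

variable (L : Type) [Field L] [NumberField L] [IsCMField L]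
variable [MeasurableSpace (quasiSplit (↥(maximalRealSubfield L)) L (IsCMField.complexConj L) 2).Adelic] [BorelSpace (quasiSplit (↥(maximalRealSubfield L)) L (IsCMField.complexConj L) 2).Adelic]

/-- **THE AXIS MODEL IDENTITY `U_{f_h} = ĥ(½+it)·U_f` — GENERATOR-WISE `U∘R(h) = M_ĥ∘U` FOR THE RADIAL PSEUDO-EISENSTEIN FAMILY OF `U(1,1)_{L∕L⁺}`.**  For a Haar measure `ν_G`, a
continuous compactly supported LEFT-`K_U`-INVARIANT `h`, `f ∈ C_c((0,∞))`, ANY scalar `cI : ℂ → ℂ` and every `t : ℝ`, in the bytes of ★ P2 `pseudoEisenstein_plancherelForm_of_fe`'s model vector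
`U_f(t) = mellin f (−(½+it)) + cI(½−it)·mellin f (−(½−it))`:
`U_{f_h}(t) = (∫ h·H^{½+it} dν_G)·U_f(t)` — §3 at `s = −(½ ± it)` and the Weyl symmetry ★ (G1) `sphericalTransform_symm_cm_two` (`ĥ(½−it) = ĥ(1−(½−it)) = ĥ(½+it)`).
[cite: MoeglinWaldspurger1995, II.2.4, IV.1.10] [cite: Iwaniec2002, §7.3] [cite: Langlands1976, §6 p. 167] -/
theorem axisModel_radialConv_eq_mul (νG : Measure (quasiSplit (↥(maximalRealSubfield L)) L (IsCMField.complexConj L) 2).Adelic) [νG.IsHaarMeasure] [SFinite νG]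
    {h : (quasiSplit (↥(maximalRealSubfield L)) L (IsCMField.complexConj L) 2).Adelic → ℂ} (hK : ∀ k : (quasiSplit (↥(maximalRealSubfield L)) L (IsCMField.complexConj L) 2).Adelic, adelicVal (↥(maximalRealSubfield L)) L (IsCMField.complexConj L) 2 ((StdForm.antidiagonal 2).over L) k ∈ standardMaximalCompactGL 2 L → ∀ x, h (k * x) = h x)
    (hhc : Continuous h) (hhs : HasCompactSupport h) {f : ℝ → ℂ} (hfc : Continuous f) (hfs : HasCompactSupport f) (hf0 : tsupport f ⊆ Ioi 0) (cI : ℂ → ℂ) (t : ℝ) :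
    mellin (fun r : ℝ => ∫ y, f (r * (borelHeight y : ℝ)) * h y ∂νG) (-((((1 / 2 : ℝ)) : ℂ) + t * I)) +
        cI ((((1 / 2 : ℝ)) : ℂ) + ((-t : ℝ) : ℂ) * I) * mellin (fun r : ℝ => ∫ y, f (r * (borelHeight y : ℝ)) * h y ∂νG) (-((((1 / 2 : ℝ)) : ℂ) + ((-t : ℝ) : ℂ) * I)) =
      (∫ x, h x * ((((borelHeight x : ℝ)) : ℂ) ^ ((((1 / 2 : ℝ)) : ℂ) + t * I)) ∂νG) *
        (mellin f (-((((1 / 2 : ℝ)) : ℂ) + t * I)) + cI ((((1 / 2 : ℝ)) : ℂ) + ((-t : ℝ) : ℂ) * I) * mellin f (-((((1 / 2 : ℝ)) : ℂ) + ((-t : ℝ) : ℂ) * I))) := by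
  rw [mellin_radialConv νG hhc hhs hfc hfs hf0, mellin_radialConv νG hhc hhs hfc hfs hf0, neg_neg, neg_neg,
    sphericalTransform_symm_cm_two L νG hK hhc hhs ((((1 / 2 : ℝ)) : ℂ) + ((-t : ℝ) : ℂ) * I)]
  have h1 : (1 : ℂ) - ((((1 / 2 : ℝ)) : ℂ) + ((-t : ℝ) : ℂ) * I) = (((1 / 2 : ℝ)) : ℂ) + t * I := by
    push_cast
    ring
  rw [h1]
  ring

end Two

end Summit.HodgeConjecture.HodgeConjecture.Cruxes.H413.K2E1PseudoEisensteinHeckeIntertwiningCMTwo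

end
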